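import Summits.BirchSwinnertonDyer.Rank1Residual.Additive.X3BranchAlgebraicCountW
import Summits.BirchSwinnertonDyer.Rank1Residual.Additive.X3BranchAnalyticHalfGordDescentEndState
import HarnessLib

/-!
# X3 on the semistable-twist locus, cell (G-ord, `e = 2`): the `W`-level branch MAIN CONJECTURE of
# the additive curve and the Λ-adic containment from PUBLISHED named facts ONLY — the displayed
# count `hAlgW` of `X3BranchAnalyticHalfGordDescent.lean` DISCHARGED by `X3BranchAlgebraicCountW.lean`
# (cell `bsd-addord`, seat `bsd-addord-twist`, strategy = twist transport; T-X3-χ closed modulo print)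

HONEST FRAMING (cell `bsd-addord`, `run/shared/lean/pub/bsd-addord/README.md` §4): the programme's
target of record is the full Birch–Swinnerton-Dyer formula for every `E/ℚ` of analytic rank `≤ 1`;
this file concerns the X3 rows (`E[p]` reducible) of cell (G-ord, `e = 2`) of N10 at an odd `p`, ON
THE BRANCH-PARITY LINE POSITION (the per-pair line datum `Φ₀`: a rational line RAMIFIED at `p`, EVEN,
whose `χ_{p*}`-twist is ramified at `p` — GV's first case for the additive curve; this excludes
`p = 3`, where the even line is unramified at `3`). THEOREMS ONLY (no `def`, no named fact, no
`sorry`); RANK-FREE. EVERY hypothesis that is not a model/line binder is a PUBLISHED named fact of the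
tree, displayed: `hW16` (Wuthrich 2014 Thm. 16), `hGV` (GV 2000 Thm. (3.12) on the branch,
reading-fact p396718), `h23` (GV 2000 §2 Cor. (2.3) + Prop. (2.4) at the datum), `h414` (Greenberg
1999 Prop. 4.14), `hGrK` (Greenberg 1999 Props. 2.2/2.4), `hLiftF` (GV 2000 p. 28/30). No OPEN
hypothesis remains. This file books nothing (the end state is the sequel; bookings are the planner's /
referee's call).

## What and why

`X3BranchAnalyticHalfGordDescent.lean` proved the `W`-level branch main conjecture
(`char_Λ X(W/ℚ_∞) = (g')`, `ι g' = u·ϖ·L_p(f_V, α, ω^m, T)`) from `hW16 ∧ hGV ∧ hAlgW`, and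
`X3BranchAnalyticHalfGordDescentEndState.lean` the end states from the same inputs; `hAlgW` was the ONE
unprinted input (GV (16)+(11) for `Sel_{p^∞}(W/ℚ_∞)`). `X3BranchAlgebraicCountW.lean` proves `hAlgW`
— with the torsion-ness of the dual module displayed — from `h23 ∧ h414 ∧ hGrK ∧ hLiftF`. Since the
torsion-ness is itself a conclusion of `hW16` at the eigen level (before the count is used), the
composition closes:

* §1 **`X3Branch.charIdeal_eq_span_of_thm312_of_algebraicCountWT`** — the sibling's TWIST DESCENT
  theorem with the displayed count weakened to its torsion-displayed form `hAlgWT` (a STRONGER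
  theorem: Wuthrich's torsion conclusion is fed to the count).
* §2 **`X3Branch.charIdeal_eq_span_of_facts`** — the `W`-LEVEL BRANCH MAIN CONJECTURE of the
  additive `W = C • V^{(p*)}` (Delbourgo's MC (G) in Greenberg form, both parities) from PUBLISHED
  facts + the line data; `X3Branch.chiBranchLowerDivisibilityAt_of_facts` (`p ≡ 1 (mod 4)`).
* the END STATE (`CycLowerLeadingTermAt`, `MissingLowerBoundAt W p`, `BSDp W p` from PUBLISHED facts
  + the line datum) is the sequel `X3BranchGordEndStateOfFacts.lean`.

## What this is NOT

Not the degenerate / `Φ₀`-unramified rows at `p = 3` (the lifting record is typed for a ramified even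
line); not the (M) cell (`hGVM` not in print); not the other branch parity (`μ > 0` expected); not rank
`1`; not `p = 2`. The line datum `Φ₀` (ramified, even, `χ`-twist ramified) stays per pair.

References: [GreenbergVatsal2000] §2 (11), (16), pp. 26–30, §3 Thm. (3.12) p. 45; [Wuthrich2014]
Thm. 16; [GreenbergLNM1716] Props. 2.2, 2.4, 4.14, §5 p. 143; [Delbourgo1998] Main Conjecture p. 151;
[SkinnerUrban2014] Thm. 3.6.4 (shape of the containment only).
-/

set_option autoImplicit false

noncomputable section

open scoped Classical MatrixGroups ModularForm

namespace Summit.BirchSwinnertonDyer.Rank1Residual.Additive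

open CongruenceSubgroup WeierstrassCurve NumberField IsDedekindDomain Field
  Literature.NumberTheory.EllipticCurves
  Literature.NumberTheory.EllipticCurves.ModularForms
  Literature.NumberTheory.EllipticCurves.GreenbergVatsal2000
  Literature.NumberTheory.EllipticCurves.Rank1Residual
  Literature.NumberTheory.EllipticCurves.Rank1Residual.Typed
  Literature.NumberTheory.GaloisRepresentations
  Summit.BirchSwinnertonDyer.Rank1Residual.X1.MuLambda
  Summit.BirchSwinnertonDyer.Rank1Residual.AdditivePotMult
  Summit.BirchSwinnertonDyer.Rank1Residual.Additive.X3Branch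

/-! ### §1 Twist descent with the torsion-displayed count -/

section Descent

variable {V : WeierstrassCurve ℚ} [V.IsElliptic] [V.IsGloballyMinimal]
  {W : WeierstrassCurve ℚ} [W.IsElliptic] [W.IsGloballyMinimal] {p : ℕ} [hp : Fact p.Prime]

/-- **TWIST DESCENT with the torsion-displayed count.** The sibling's
`X3Branch.charIdeal_eq_span_of_thm312_of_algebraicCountW` VERBATIM, except that the displayed count
`hAlgWT` additionally receives `D.IsTorsion` — which the proof supplies from Wuthrich's Thm. 16 at
the `χ_K`-eigen datum over `ℚ(μ_{p^∞})` (same `Λ`-module, `exists_chiEigenInCyclotomic`) before the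
pointwise composition `X3Branch.charIdeal_eq_span_of_thm312_of_count` consumes the count. Conclusion:
`X(W/ℚ_∞)` is `Λ`-torsion and `char_Λ X(W/ℚ_∞) = (g')`, `ι g' = u·ϖ·L_p(f_V, α_V, ω^m, T)`.
[cite: GreenbergLNM1716, §5 (PDF p. 143)] [cite: GreenbergVatsal2000, p. 4, §2 (16), §3 Thm. (3.12) p. 45]
[cite: Wuthrich2014, Thm. 16 (p. 397)] [cite: Delbourgo1998, Main Conjecture (p. 151)] -/
theorem X3Branch.charIdeal_eq_span_of_thm312_of_algebraicCountWT
    (hW16 : Wuthrich2014.thm16_halfEigenCharIdeal_dvd_cyclotomicPrime)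
    (hGV : thm312_branch_unitContent_and_lambda_eq_residual_goodOrd)
    (hp2 : p ≠ 2) (hgood : GoodOrd V p) {C : VariableChange ℚ}
    (hC : C • V.quadraticTwist ((-1) ^ (p / 2) * p : ℚ) = W)
    (S₀ : Finset (HeightOneSpectrum (𝓞 ℚ))) (hS₀ : ∀ v ∈ S₀, ((p : ℕ) : 𝓞 ℚ) ∉ v.asIdeal)
    (hS : ∀ v : HeightOneSpectrum (𝓞 ℚ), v ∉ S₀ → ((p : ℕ) : 𝓞 ℚ) ∉ v.asIdeal →
      W.HasGoodReductionAt v)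
    (Φ₀ : AddSubgroup (W.geomTorsion (p : ℤ))) (hΦ : IsRationalLine W p Φ₀)
    (heven : LineEven W p Φ₀)
    (hnt : ∃ (σ : absoluteGaloisGroup ℚ) (P : W.geomTorsion (p : ℤ)), P ∈ Φ₀ ∧ σ • P ≠ P)
    (hram : ∀ (K : Type) [Field K] [NumberField K] [(galRange (K := ℚ) K).Normal],
      Module.finrank ℚ K = 2 → (∃ θ : K, θ ^ 2 = algebraMap ℚ K ((-1) ^ (p / 2) * p)) →
      ¬ ∀ v : HeightOneSpectrum (𝓞 ℚ), ((p : ℕ) : 𝓞 ℚ) ∈ v.asIdeal →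
        ∀ 𝔓 ∈ v.primesAbove, ∀ σ ∈ 𝔓.inertia (absoluteGaloisGroup ℚ), ∀ P ∈ Φ₀,
          σ • P = (if σ ∈ galRange (K := ℚ) K then P else -P))
    (hAlgWT : ∀ {κ : ZpExtension ℚ p} {γ : Field.absoluteGaloisGroup ℚ} (D : W.SelmerDualData κ γ)
      (g : IwasawaAlgebra p), κ.IsCyclotomic → κ.IsTopGenerator γ → D.IsTorsion →
      D.charIdeal = Ideal.span {g} → HasUnitContent g →
        p ^ (lam g + ∑ v ∈ S₀, delta W p v) =
          Nat.card (residualLineH1 W p κ S₀ Φ₀ hΦ) * Nat.card (residualQuotSelmer W p κ S₀ Φ₀ hΦ))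
    {κ : ZpExtension ℚ p} {γ : Field.absoluteGaloisGroup ℚ} {N : ℕ} [NeZero N]
    {f : CuspForm (Gamma0 N) 2}
    (hκ : κ.IsCyclotomic) (hγ : κ.IsTopGenerator γ) (hcv : IsCyclotomicVariable p γ)
    (hf : IsNewformOf V f) (D : W.SelmerDualData κ γ) (ϖ : ℚ)
    (hϖ : if Even (p / 2) then (ϖ : ℝ) * V.realPeriodRat = plusPeriod f
        else (ϖ : ℝ) * V.imaginaryPeriodRat = minusPeriod f) :
    D.IsTorsion ∧ ∃ g' : IwasawaAlgebra p, D.charIdeal = Ideal.span {g'} ∧ ∃ u : ℤ_[p]ˣ,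
      iwasawaToPowerSeries p g' =
        PowerSeries.C (((u : ℤ_[p]) : ℚ_[p]) * (ϖ : ℚ_[p])) *
          (if Even (p / 2) then padicLFunctionBranch f ((unitRoot V p : ℤ_[p]) : ℚ_[p]) (p / 2)
            else padicLFunctionMinusBranch f ((unitRoot V p : ℤ_[p]) : ℚ_[p]) (p / 2)) := by
  have hpS : ((-1 : ℚ) ^ (p / 2) * p) ≠ 0 := pStar_ne_zero p
  have hord : IsOrdinaryAt V p := (isOrdinaryAt_iff V p).mpr ⟨hgood.1, hgood.2⟩
  -- `W[p]` has the rational line `Φ₀`, so `V[p]` is reducible too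
  have hirr : ¬ V.HasIrreducibleModPGaloisRep p := fun hV ↦
    not_hasIrreducibleModPGaloisRep_of_isRationalLine hΦ
      ((irr_iff_of_model_twist (W := V) (p := p) hpS ⟨C, hC⟩).mpr hV)
  -- descend `D` to the `χ_K`-eigen datum over `ℚ(μ_{p^∞})`
  haveI hcycL : IsCyclotomicExtension {p} ℚ (CyclotomicField p ℚ) := by
    have h : (CyclotomicField.algebra p ℚ : Algebra ℚ (CyclotomicField p ℚ)) =
        DivisionRing.toRatAlgebra := Subsingleton.elim _ _
    exact h ▸ CyclotomicField.isCyclotomicExtension p ℚ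
  obtain ⟨K, θ, hK2, hθ, hθ2⟩ := exists_intermediateField_sq_eq_pStar p (CyclotomicField p ℚ) hp2
  haveI : NumberField K := NumberField.of_module_finite ℚ K
  haveI : IsGalois ℚ K := isGalois_of_finrank_eq_two K hK2
  haveI := normal_galRange K hK2 (sigmaQ_ne_one K hK2 hθ hθ2)
  haveI := normal_galRange_cyclotomic p (CyclotomicField p ℚ)
  haveI : (V.quadraticTwist ((-1 : ℚ) ^ (p / 2) * p)).IsElliptic := V.isElliptic_quadraticTwist hpS
  obtain ⟨γ', hγ'KF, hκγ', ⟨g₀, hg₀, hγ'eq⟩, D', hchar, htor⟩ :=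
    SelmerDualData.exists_chiEigenInCyclotomic p (CyclotomicField p ℚ) V K hK2 hθ hθ2 κ hC hp2 D
  -- Wuthrich's Thm. 16 at the eigen datum: the module `D'.X = D.X` is `Λ`-torsion
  have hγ' : κ.IsTopGenerator γ' := isTopGenerator_of_kappa_eq κ hκγ' hγ
  have hcv' : IsCyclotomicVariable p γ' := isCyclotomicVariable_of_eq_mul p κ hκ hg₀ hγ'eq hcv
  obtain ⟨htorsE, -⟩ := hW16 p V K (CyclotomicField p ℚ) _ hp2 hK2 ⟨θ, hθ2⟩ (Or.inl ⟨hord, rfl⟩)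
    hirr hκ hγ' hcv' (Subgroup.mem_inf.mp hγ'KF).1 (Subgroup.mem_inf.mp hγ'KF).2 hf
    (ChiEigenSelmerInDualData.toEigen V K κ (galRange (K := ℚ) (CyclotomicField p ℚ)) γ' D') ϖ hϖ
  have htorsD : D.IsTorsion := htor.mp htorsE
  -- the pointwise composition at the Literature eigen datum with the SAME module
  have key := X3Branch.charIdeal_eq_span_of_thm312_of_count (V := V) (W := W) hW16 hGV hgood ⟨C, hC⟩
    S₀ hS₀ hS Φ₀ hΦ heven hnt K (CyclotomicField p ℚ) (κ := κ) (γ := γ') (f := f) hp2 hK2 ⟨θ, hθ2⟩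
    (hram K hK2 ⟨θ, hθ2⟩) hirr hκ hγ' hcv'
    (Subgroup.mem_inf.mp hγ'KF).1 (Subgroup.mem_inf.mp hγ'KF).2 hf
    (ChiEigenSelmerInDualData.toEigen V K κ (galRange (K := ℚ) (CyclotomicField p ℚ)) γ' D') ϖ hϖ
    (fun g hg hμ ↦ hAlgWT D g hκ hγ htorsD (hchar ▸ hg) hμ)
  obtain ⟨-, g', hchar', u, hι⟩ := key
  exact ⟨htorsD, g', hchar ▸ hchar', u, hι⟩

end Descent

/-! ### §2 The `W`-level branch main conjecture and the Λ-adic containment FROM PUBLISHED FACTS -/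

section OfFacts

variable {V : WeierstrassCurve ℚ} [V.IsElliptic] [V.IsGloballyMinimal]
  {W : WeierstrassCurve ℚ} [W.IsElliptic] [W.IsGloballyMinimal] {p : ℕ} [hp : Fact p.Prime]

omit [W.IsElliptic] [W.IsGloballyMinimal] in
/-- A rational line RAMIFIED at `p` carries a non-trivial `Γ_ℚ`-action (some inertia element above
`p` moves a point; tree `exists_inertia_smul_ne_of_not_lineUnramifiedAt`). [folklore] -/
theorem exists_smul_ne_of_not_lineUnramifiedAt {Φ₀ : AddSubgroup (W.geomTorsion (p : ℤ))}
    (hΦ : IsRationalLine W p Φ₀) (hram0 : ¬ LineUnramifiedAt W p Φ₀) :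
    ∃ (σ : absoluteGaloisGroup ℚ) (P : W.geomTorsion (p : ℤ)), P ∈ Φ₀ ∧ σ • P ≠ P := by
  obtain ⟨v, hv⟩ :=
    Literature.NumberTheory.NumberFields.RingOfIntegers.exists_heightOneSpectrum_natCast_mem ℚ hp.out
  obtain ⟨𝔓, h𝔓⟩ := HeightOneSpectrum.primesAbove_nonempty v
  obtain ⟨σ, -, P, hP, hne⟩ := exists_inertia_smul_ne_of_not_lineUnramifiedAt hΦ hram0 v hv 𝔓 h𝔓
  exact ⟨σ, P, hP, hne⟩

/-- **THE `W`-LEVEL BRANCH MAIN CONJECTURE OF THE ADDITIVE CURVE FROM PUBLISHED FACTS** (Delbourgo's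
Main Conjecture (G) for `E = W` in Greenberg form, both parities, on the branch-parity line position).
`V` GOOD ORDINARY at the odd `p`, `C • V^{(p*)} = W`; `Σ₀ ∌ p` finite with the bad places `≠ p`
inside; `Φ₀ ≤ W[p]` a rational line RAMIFIED at `p`, EVEN, whose `χ_K`-twist is ramified at `p` for
every quadratic `K` with `θ² = p*`; `κ` cyclotomic, `γ` a topological generator matching the
cyclotomic variable, `f` the newform of `V`, `D` ANY `Λ`-dual datum of `Sel_{p^∞}(W/ℚ_∞)`, `ϖ` the
period ratio of the parity of `m = (p−1)/2`. THEN `X(W/ℚ_∞)` is `Λ`-torsion and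
`char_Λ X(W/ℚ_∞) = (g')` with `ι g' = u·ϖ·L_p(f_V, α_V, ω^m, T)`, `u ∈ ℤ_pˣ` — GRANTED ONLY the
PUBLISHED records `hW16` (Wuthrich Thm. 16), `hGV` (GV Thm. (3.12) on the branch), `h23` (GV Cor.
(2.3)/Prop. (2.4) at the datum), `h414` (Greenberg Prop. 4.14), `hGrK` (Greenberg Props. 2.2/2.4),
`hLiftF` (GV p. 28/30). §1 composed with `X3Branch.algebraicCountW_of_facts`.
[cite: Delbourgo1998, Main Conjecture (p. 151)] [cite: GreenbergVatsal2000, §2 (11), (16), pp. 26–30; §3 Thm. (3.12) p. 45]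
[cite: Wuthrich2014, Thm. 16 (p. 397)] [cite: GreenbergLNM1716, Props. 2.2, 2.4, 4.14; §5 p. 143] -/
theorem X3Branch.charIdeal_eq_span_of_facts
    (hW16 : Wuthrich2014.thm16_halfEigenCharIdeal_dvd_cyclotomicPrime)
    (hGV : thm312_branch_unitContent_and_lambda_eq_residual_goodOrd)
    (h23 : datumSelmer_nonPrimitive_invariants)
    (h414 : Greenberg1999.prop414_noFiniteSubmodule_of_not_dvd_torsionOrder)
    (hGrK : Greenberg1999.imKummer_ge_strictCondition_goodOrdinary)
    (hLiftF : residualEpsilon_surjOn_of_lineRamifiedEven)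
    (hp2 : p ≠ 2) (hgood : GoodOrd V p) {C : VariableChange ℚ}
    (hC : C • V.quadraticTwist ((-1) ^ (p / 2) * p : ℚ) = W)
    (S₀ : Finset (HeightOneSpectrum (𝓞 ℚ))) (hS₀ : ∀ v ∈ S₀, ((p : ℕ) : 𝓞 ℚ) ∉ v.asIdeal)
    (hS : ∀ v : HeightOneSpectrum (𝓞 ℚ), v ∉ S₀ → ((p : ℕ) : 𝓞 ℚ) ∉ v.asIdeal →
      W.HasGoodReductionAt v)
    (Φ₀ : AddSubgroup (W.geomTorsion (p : ℤ))) (hΦ : IsRationalLine W p Φ₀)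
    (hram0 : ¬ LineUnramifiedAt W p Φ₀) (heven : LineEven W p Φ₀)
    (hram : ∀ (K : Type) [Field K] [NumberField K] [(galRange (K := ℚ) K).Normal],
      Module.finrank ℚ K = 2 → (∃ θ : K, θ ^ 2 = algebraMap ℚ K ((-1) ^ (p / 2) * p)) →
      ¬ ∀ v : HeightOneSpectrum (𝓞 ℚ), ((p : ℕ) : 𝓞 ℚ) ∈ v.asIdeal →
        ∀ 𝔓 ∈ v.primesAbove, ∀ σ ∈ 𝔓.inertia (absoluteGaloisGroup ℚ), ∀ P ∈ Φ₀,
          σ • P = (if σ ∈ galRange (K := ℚ) K then P else -P))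
    {κ : ZpExtension ℚ p} {γ : Field.absoluteGaloisGroup ℚ} {N : ℕ} [NeZero N]
    {f : CuspForm (Gamma0 N) 2}
    (hκ : κ.IsCyclotomic) (hγ : κ.IsTopGenerator γ) (hcv : IsCyclotomicVariable p γ)
    (hf : IsNewformOf V f) (D : W.SelmerDualData κ γ) (ϖ : ℚ)
    (hϖ : if Even (p / 2) then (ϖ : ℝ) * V.realPeriodRat = plusPeriod f
        else (ϖ : ℝ) * V.imaginaryPeriodRat = minusPeriod f) :
    D.IsTorsion ∧ ∃ g' : IwasawaAlgebra p, D.charIdeal = Ideal.span {g'} ∧ ∃ u : ℤ_[p]ˣ,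
      iwasawaToPowerSeries p g' =
        PowerSeries.C (((u : ℤ_[p]) : ℚ_[p]) * (ϖ : ℚ_[p])) *
          (if Even (p / 2) then padicLFunctionBranch f ((unitRoot V p : ℤ_[p]) : ℚ_[p]) (p / 2)
            else padicLFunctionMinusBranch f ((unitRoot V p : ℤ_[p]) : ℚ_[p]) (p / 2)) :=
  X3Branch.charIdeal_eq_span_of_thm312_of_algebraicCountWT hW16 hGV hp2 hgood hC S₀ hS₀ hS Φ₀ hΦ heven
    (exists_smul_ne_of_not_lineUnramifiedAt hΦ hram0) hram
    (fun D g hκ' hγ' hDt hg hμ ↦ X3Branch.algebraicCountW_of_facts h23 h414 hGrK hLiftF hp2 V hgood hC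
      S₀ hS₀ hS Φ₀ hΦ hram0 heven hram D g hκ' hγ' hDt hg hμ)
    hκ hγ hcv hf D ϖ hϖ

omit [V.IsElliptic] [V.IsGloballyMinimal] in
/-- **`p ≡ 1 (mod 4)`: the Λ-adic integral containment `ChiBranchLowerDivisibilityAt W p` FROM
PUBLISHED FACTS** + the line data (twin of the sibling's
`X3Branch.chiBranchLowerDivisibilityAt_of_thm312_of_algebraicCountW`; the def supplies the
good-ordinary twist model). [cite: SkinnerUrban2014, Thm. 3.6.4 (p. 43) (shape only)]
[cite: GreenbergVatsal2000, §3 Thm. (3.12) p. 45] [cite: Wuthrich2014, Thm. 16 (p. 397)] -/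
theorem X3Branch.chiBranchLowerDivisibilityAt_of_facts
    (hW16 : Wuthrich2014.thm16_halfEigenCharIdeal_dvd_cyclotomicPrime)
    (hGV : thm312_branch_unitContent_and_lambda_eq_residual_goodOrd)
    (h23 : datumSelmer_nonPrimitive_invariants)
    (h414 : Greenberg1999.prop414_noFiniteSubmodule_of_not_dvd_torsionOrder)
    (hGrK : Greenberg1999.imKummer_ge_strictCondition_goodOrdinary)
    (hLiftF : residualEpsilon_surjOn_of_lineRamifiedEven)
    (S₀ : Finset (HeightOneSpectrum (𝓞 ℚ))) (hS₀ : ∀ v ∈ S₀, ((p : ℕ) : 𝓞 ℚ) ∉ v.asIdeal)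
    (hS : ∀ v : HeightOneSpectrum (𝓞 ℚ), v ∉ S₀ → ((p : ℕ) : 𝓞 ℚ) ∉ v.asIdeal →
      W.HasGoodReductionAt v)
    (Φ₀ : AddSubgroup (W.geomTorsion (p : ℤ))) (hΦ : IsRationalLine W p Φ₀)
    (hram0 : ¬ LineUnramifiedAt W p Φ₀) (heven : LineEven W p Φ₀)
    (hram : ∀ (K : Type) [Field K] [NumberField K] [(galRange (K := ℚ) K).Normal],
      Module.finrank ℚ K = 2 → (∃ θ : K, θ ^ 2 = algebraMap ℚ K ((-1) ^ (p / 2) * p)) →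
      ¬ ∀ v : HeightOneSpectrum (𝓞 ℚ), ((p : ℕ) : 𝓞 ℚ) ∈ v.asIdeal →
        ∀ 𝔓 ∈ v.primesAbove, ∀ σ ∈ 𝔓.inertia (absoluteGaloisGroup ℚ), ∀ P ∈ Φ₀,
          σ • P = (if σ ∈ galRange (K := ℚ) K then P else -P)) :
    ChiBranchLowerDivisibilityAt W p := by
  intro V _ _ κ γ N _ f hp1 hCW hgood hκ hγ hcv hf D ϖ hϖ g hg
  have hp2 : p ≠ 2 := by omega
  have heven' : Even (p / 2) := ⟨p / 4, by omega⟩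
  obtain ⟨C, hC⟩ := hCW
  have hC' : C • V.quadraticTwist ((-1) ^ (p / 2) * p : ℚ) = W := by
    rw [pStar_eq_self_of_mod_four_eq_one hp1]; exact hC
  obtain ⟨-, g', hchar, u, hι⟩ := X3Branch.charIdeal_eq_span_of_facts hW16 hGV h23 h414 hGrK hLiftF
    hp2 hgood hC' S₀ hS₀ hS Φ₀ hΦ hram0 heven hram hκ hγ hcv hf D ϖ (by rw [if_pos heven']; exact hϖ)
  rw [if_pos heven'] at hι
  have hg' : g ∈ Ideal.span ({g'} : Set (IwasawaAlgebra p)) := by rw [← hchar]; exact hg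
  obtain ⟨a, rfl⟩ := Ideal.mem_span_singleton'.mp hg'
  refine ⟨PowerSeries.C (u : ℤ_[p]) * a, ?_⟩
  have hCu : PowerSeries.C ((((u : ℤ_[p]) : ℚ_[p])) * (ϖ : ℚ_[p])) =
      PowerSeries.C (((u : ℤ_[p]) : ℚ_[p])) * PowerSeries.C (ϖ : ℚ_[p]) := map_mul _ _ _
  rw [map_mul, hι, iwasawaToPowerSeries_C_mul', hCu]
  ring

end OfFacts
end Summit.BirchSwinnertonDyer.Rank1Residual.Additive

end
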